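import Summits.BirchSwinnertonDyer.BirchSwinnertonDyer.Theorems.ManinLocalTwoThreeKummerCubeRootSigmaPrelims
import Summits.BirchSwinnertonDyer.BirchSwinnertonDyer.Theorems.ManinLocalTwoThreeKummerCubeSigmaTangentLine
import Summits.BirchSwinnertonDyer.BirchSwinnertonDyer.Theorems.ManinLocalTwoThreeKummerCubeSigmaLeaves
import HarnessLib

/-!
# (AN2-b) The cube root of the Kummer cube series IS `κ · t_s · W_u(c·E_f)` near `i∞`
(route `ManinLocalTwoThree`, crux C3 `ManinPrimeToThreeAtNine` stmt-BirchSwinnertonDyer-22968; cell bsd-f2-manin, p2 gen 17;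
`--supports stmt-BirchSwinnertonDyer-22968`; sub-piece (AN2-b) of the UDC-line content stub AN♮ / AN2 `KummerCubeRootModularForm`)

**`exists_hasSum_const_mul_shortT_mul_sigmaCubeRoot`.**  For a globally minimal `W`, an `X₀(N)`-datum `D` with integral newform coefficients,
a rational point `(X₀, Y₀)` of order `3` on the short model `E_{W,c}`, THE germ `z`, and ANY formal `h ∈ ℚ⟦q⟧` with `h³ = Θ_T :=
kummerCubeSeries W c X₀ Y₀ z`, `h(0) = −1`: there are `u ∉ Λ` with `3u = m₁ω₁ + m₂ω₂`, `(c²℘(u), c³℘′(u)/2) = (X₀, Y₀)` (S6), a constant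
`κ ≠ 0` and `B` such that for `Im τ > B`

  `Σₙ hₙ·𝕢₁(τ)ⁿ = κ · t_s(τ) · W_{u, m₁η₁+m₂η₂}(c·E_f(τ))`   (`HasSum`),

where `t_s = shortT D` and `W = sigmaCubeRoot D.L` are the objects of an's σ-monodromy line.  So the q-SERIES WITH THE (BI)/(AN1)-INTEGRAL
COEFFICIENTS `hₙ` is, high in the strip, the σ-expression whose `Γ₀(N)`-monodromy is the Kummer character (p3's `sigmaCubeRoot_periodic_iff`):
exactly the input from which (AN2) builds its modular form `F = (κ t_s W_u)·P(j)^e·Δ^k`.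

PROOF.  (p727203, AN2-a) a holomorphic `R`, analytic at `0`, with `Σ hₙqⁿ → R(q)` and `R(𝕢₁τ)³ = Θ̂_T(τ)`; (S6 + S3′ + S3) `Θ̂_T = c³t_s³ℓ_u(w) =
(c³C)·(t_s·W_u(w))³`, `w = c·E_f(τ) ∉ Λ`; (prelims) `t_s·W_u(w) = Φ(w)` with `Φ` analytic at `w = 0`, `Φ(0) ≠ 0`, and `w = c·ε(q)` with an's
analytic `q`-germ `ε` — so `R³ = K·Ψ³` on a punctured `q`-disc, `Ψ = Φ∘(c·ε)` analytic at `0`, hence at `q = 0` by continuity; with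
`κ := R(0)/Ψ(0)` the germs `κΨ` and `R` have Taylor series with equal cubes and equal constant terms, so (`eq_of_pow_eq_of_constantCoeff_eq`,
`taylorAt0_pow/congr`) equal Taylor series, hence `κΨ = R` near `0` (`exists_hasSum_taylorAt0`), i.e. for `Im τ` large.

HONEST FRAMING.  Together with p727203 this closes the «h ↔ h^{an}» half of AN2; the modular-form half (poles of `t_s·W_u`, the `P(j)^e·Δ^k`
multiplier — needing the algebraicity of `j` on `φ⁻¹(E[2])`, p2's note 14:5xZ — growth at the other cusps) remains OPEN, as do AN♮, C3 and C2.
BSD is not proved by this; Manin's conjecture is not proved. [folklore]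
-/

set_option autoImplicit false
-- lint-debt: the directory name repeats the summit name (sibling precedent `ManinLocalTwoThreeKummerCubeSigmaLeaves.lean`)
set_option linter.dupNamespace false

noncomputable section

open scoped Topology PeriodPair
open Complex Filter PowerSeries
open Literature.NumberTheory.EllipticCurves Literature.NumberTheory.EllipticCurves.ModularForms
open Summit.BirchSwinnertonDyer.Rank1Residual.ManinAdditive.CuspidalKummer
open Summit.BirchSwinnertonDyer.Rank1Residual.ManinAdditive.CuspidalKummerThree
open Summit.BirchSwinnertonDyer.Rank1Residual.ManinAdditive.KummerCubeMonodromy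
open Summit.BirchSwinnertonDyer.BirchSwinnertonDyer.Theorems.ManinLocalTwoThree.KummerCubeAnalytic
open Summit.BirchSwinnertonDyer.BirchSwinnertonDyer.Theorems.ManinLocalTwoThree.KummerCubeSigmaLeaves

namespace Summit.BirchSwinnertonDyer.BirchSwinnertonDyer.Theorems.ManinLocalTwoThree.KummerCubeRootDictionary

/-- Two germs continuous at `0` that agree on a punctured neighbourhood of `0` agree at `0`. [folklore] -/
theorem eq_at_zero_of_eventuallyEq {F G : ℂ → ℂ} (hF : ContinuousAt F 0) (hG : ContinuousAt G 0)
    (h : ∀ᶠ q in 𝓝[≠] (0 : ℂ), F q = G q) : F 0 = G 0 :=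
  tendsto_nhds_unique_of_eventuallyEq (hF.tendsto.mono_left nhdsWithin_le_nhds)
    (hG.tendsto.mono_left nhdsWithin_le_nhds) h

/-- Two germs analytic at `0` with the same Taylor series agree near `0`. [folklore] -/
theorem eventuallyEq_of_taylorAt0_eq {F G : ℂ → ℂ} (hF : AnalyticAt ℂ F 0) (hG : AnalyticAt ℂ G 0)
    (h : taylorAt0 F = taylorAt0 G) : ∀ᶠ q in 𝓝 (0 : ℂ), F q = G q := by
  obtain ⟨r₁, hr₁, h₁⟩ := exists_hasSum_taylorAt0 hF
  obtain ⟨r₂, hr₂, h₂⟩ := exists_hasSum_taylorAt0 hG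
  have hball : Metric.ball (0 : ℂ) (min r₁ r₂) ∈ 𝓝 (0 : ℂ) := Metric.ball_mem_nhds 0 (lt_min hr₁ hr₂)
  filter_upwards [hball] with q hq
  rw [Metric.mem_ball, dist_zero_right] at hq
  have hs₁ := h₁ q (hq.trans_le (min_le_left _ _))
  have hs₂ := h₂ q (hq.trans_le (min_le_right _ _))
  rw [h] at hs₁
  exact hs₁.unique hs₂

/-- **(AN2-b) The cube root of the Kummer cube series is `κ·t_s·W_u(c·E_f)` near `i∞`** (statement and proof in the module docstring).
[folklore] -/
theorem exists_hasSum_const_mul_shortT_mul_sigmaCubeRoot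
    (W : WeierstrassCurve ℚ) [W.IsElliptic] [W.IsGloballyMinimal] {N : ℕ} [NeZero N]
    (D : ModularParametrizationData W N) (a : ℕ → ℤ) (ha : ∀ n, (a n : ℂ) = cuspCoeff D.f n)
    (X₀ Y₀ : ℚ) (hT : IsShortThreeTorsion W D.c X₀ Y₀) (z : ℚ⟦X⟧) (hz : IsParamGerm W D.c a z)
    (h : ℚ⟦X⟧) (hh3 : h ^ 3 = kummerCubeSeries W D.c X₀ Y₀ z) (hh0 : constantCoeff h = -1) :
    ∃ (u : ℂ) (m₁ m₂ : ℤ) (κ : ℂ) (B : ℝ), u ∉ D.L.lattice ∧ 3 * u = m₁ * D.L.ω₁ + m₂ * D.L.ω₂ ∧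
      (D.c : ℂ) ^ 2 * ℘[D.L] u = (X₀ : ℂ) ∧ (D.c : ℂ) ^ 3 * ℘'[D.L] u / 2 = (Y₀ : ℂ) ∧ κ ≠ 0 ∧
      ∀ τ : UpperHalfPlane, B < τ.im →
        HasSum (fun n : ℕ => ((coeff n h : ℚ) : ℂ) * Function.Periodic.qParam 1 (τ : ℂ) ^ n)
          (κ * (shortT D τ * sigmaCubeRoot D.L u (m₁ * D.L.η₁ + m₂ * D.L.η₂) ((D.c : ℂ) * eichlerIntegral D.f τ))) := by
  -- S6: the analytic lift `u` of the `3`-torsion point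
  obtain ⟨hc0, u, hu, h3u, h℘'u, hX, hY⟩ := shortThreeTorsionLift W D X₀ Y₀ hT
  obtain ⟨m₁, m₂, hm⟩ := PeriodPair.mem_lattice.mp h3u
  have hc : (D.c : ℂ) ≠ 0 := Int.cast_ne_zero.mpr hc0
  set e : ℂ := m₁ * D.L.η₁ + m₂ * D.L.η₂ with he
  -- S3 and S3′
  obtain ⟨C, hC0, hS3⟩ := sigmaTangentLineIdentity D.L u m₁ m₂ hu hm.symm
  have hS3' := tangentLineScaling W D X₀ Y₀ u hX hY h℘'u
  -- prelims: `t_s·W = Φ(w)` with `Φ` analytic at `0`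
  obtain ⟨Φ, P₃, hΦan, hΦ0, hP₃d, hP₃0, hΦeq⟩ := exists_analytic_shortT_mul_sigmaCubeRoot D hc0 hu e
  -- AN2-a: the holomorphic cube root `R` with `q`-coefficients `hₙ`
  obtain ⟨R, B₁, hRan, hR0, hR⟩ := exists_hasSum_cubeRoot_kummerCubeSeries W D a ha hc0 X₀ Y₀ z hz h hh3 hh0
  -- `q → 0`: `w = c·ε(q) ∉ Λ` and `P₃(w) ≠ 0`
  have hf1 : cuspCoeff D.f 1 = 1 := by
    rw [D.isNewformOf.2 1, W.isMultiplicative_LFunction.map_one]; simp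
  have hev := eventually_smul_qGerm_notMem D.f hf1 D.L hc hP₃d.continuous.continuousAt (by rw [hP₃0]; norm_num)
  obtain ⟨B₂, hB₂⟩ := exists_im_bound_of_eventually hev
  -- the cube identity high in the strip: `R(q)³ = K·Φ(w)³`, `K = c³C`
  set K : ℂ := (D.c : ℂ) ^ 3 * C with hK
  set Ψ : ℂ → ℂ := fun q => Φ ((D.c : ℂ) * qGerm D.f q) with hΨ
  have hΨan : AnalyticAt ℂ Ψ 0 := by
    have hinner : AnalyticAt ℂ (fun q : ℂ => (D.c : ℂ) * qGerm D.f q) 0 :=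
      analyticAt_const.mul (analyticAt_qGerm D.f)
    have h0 : (fun q : ℂ => (D.c : ℂ) * qGerm D.f q) 0 = 0 := by simp [qGerm_zero]
    have hcomp : AnalyticAt ℂ (Φ ∘ fun q : ℂ => (D.c : ℂ) * qGerm D.f q) 0 := hΦan.comp_of_eq hinner h0
    rw [hΨ]
    exact hcomp
  have hΨ0 : Ψ 0 = Φ 0 := by simp [hΨ, qGerm_zero]
  have hΨτ : ∀ τ : UpperHalfPlane, Ψ (Function.Periodic.qParam 1 (τ : ℂ)) = Φ ((D.c : ℂ) * eichlerIntegral D.f τ) := by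
    intro τ; simp [hΨ, qGerm_apply]
  have hcube : ∀ τ : UpperHalfPlane, max B₁ B₂ < τ.im →
      R (Function.Periodic.qParam 1 (τ : ℂ)) ^ 3 = K * Ψ (Function.Periodic.qParam 1 (τ : ℂ)) ^ 3 := by
    intro τ hτ
    have h1 : B₁ < τ.im := (le_max_left _ _).trans_lt hτ
    have h2 : B₂ < τ.im := (le_max_right _ _).trans_lt hτ
    obtain ⟨hwΛ, hP₃w⟩ := hB₂ τ h2
    rw [qGerm_apply] at hwΛ hP₃w
    rw [(hR τ h1).2.1, hS3' τ, hS3 _ hwΛ, hΨτ, ← hΦeq τ hwΛ hP₃w, hK]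
    ring
  have hev3 : ∀ᶠ q in 𝓝[≠] (0 : ℂ), R q ^ 3 = K * Ψ q ^ 3 := eventually_nhdsWithin_of_forall_im_gt hcube
  -- at `q = 0` by continuity, hence on a full neighbourhood
  have h0 : R 0 ^ 3 = K * Ψ 0 ^ 3 :=
    eq_at_zero_of_eventuallyEq (F := fun q => R q ^ 3) (G := fun q => K * Ψ q ^ 3)
      (hRan.continuousAt.pow 3) (continuousAt_const.mul (hΨan.continuousAt.pow 3)) hev3
  have hfull : ∀ᶠ q in 𝓝 (0 : ℂ), R q ^ 3 = K * Ψ q ^ 3 := by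
    have h' := eventually_nhdsWithin_iff.mp hev3
    filter_upwards [h'] with q hq
    by_cases hq0 : q = 0
    · subst hq0; exact h0
    · exact hq hq0
  -- the constant `κ`
  have hΨ0ne : Ψ 0 ≠ 0 := by rw [hΨ0]; exact hΦ0
  set κ : ℂ := R 0 / Ψ 0 with hκdef
  have hκ0 : κ ≠ 0 := div_ne_zero (by rw [hR0]; norm_num) hΨ0ne
  have hκ3 : κ ^ 3 = K := by
    rw [hκdef, div_pow, div_eq_iff (pow_ne_zero 3 hΨ0ne)]
    exact h0
  -- `κΨ` and `R`: equal cubes near `0`, equal values at `0`, hence equal Taylor series, hence equal near `0`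
  have hGan : AnalyticAt ℂ (fun q => κ * Ψ q) 0 := analyticAt_const.mul hΨan
  have hT : taylorAt0 (fun q => κ * Ψ q) = taylorAt0 R := by
    have hpow : taylorAt0 (fun q => κ * Ψ q) ^ 3 = taylorAt0 R ^ 3 := by
      rw [← taylorAt0_pow hGan 3, ← taylorAt0_pow hRan 3]
      apply taylorAt0_congr
      filter_upwards [hfull] with q hq
      rw [mul_pow, hκ3, hq]
    have hcc : constantCoeff (taylorAt0 (fun q => κ * Ψ q)) = constantCoeff (taylorAt0 R) := by
      rw [constantCoeff_taylorAt0, constantCoeff_taylorAt0, hκdef, div_mul_cancel₀ _ hΨ0ne]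
    refine eq_of_pow_eq_of_constantCoeff_eq three_ne_zero hpow hcc ?_
    rw [hcc, constantCoeff_taylorAt0, hR0]; norm_num
  have heq := eventuallyEq_of_taylorAt0_eq hGan hRan hT
  obtain ⟨B₃, hB₃⟩ := exists_im_bound_of_eventually (heq.filter_mono nhdsWithin_le_nhds)
  -- assemble
  refine ⟨u, m₁, m₂, κ, max (max B₁ B₂) B₃, hu, hm.symm, hX, hY, hκ0, fun τ hτ => ?_⟩
  have h12 : max B₁ B₂ < τ.im := (le_max_left _ _).trans_lt hτ
  have h1 : B₁ < τ.im := (le_max_left _ _).trans_lt h12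
  have h2 : B₂ < τ.im := (le_max_right _ _).trans_lt h12
  have h3 : B₃ < τ.im := (le_max_right _ _).trans_lt hτ
  obtain ⟨hwΛ, hP₃w⟩ := hB₂ τ h2
  rw [qGerm_apply] at hwΛ hP₃w
  have hsum := (hR τ h1).1
  rw [← hB₃ τ h3, hΨτ τ, ← hΦeq τ hwΛ hP₃w] at hsum
  exact hsum

end Summit.BirchSwinnertonDyer.BirchSwinnertonDyer.Theorems.ManinLocalTwoThree.KummerCubeRootDictionary

end
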